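import Summits.QuantumFields.BalabanUV.T4Continuum.Support.NE3FlatHodgeSplit
import Summits.QuantumFields.BalabanUV.T4Continuum.Support.NE7FlatAverageCurlCommutation
import HarnessLib

/-!
# NE7PeriodicDeRhamOneForms — THE DISCRETE DE RHAM THEOREM FOR PERIODIC 1-FORMS ON THE LATTICE TORUS: A CLOSED PERIODIC 1-FORM IS A CONSTANT PLUS AN EXACT FORM
# (complex-valued, matrix-valued, and `𝔲(n)`-valued with `𝔲(n)`-valued potential and constant), every `d`, every period `P ≥ 1`

ROAD-G115 §11 (ii) of the lineage `b2b-balaban-t4-ne7-p1` (CRUX PROVER NE7 #1 = OWNER of BINDER row NE7), generation 116: the missing link «closed = exact ⊕ constants on the periodic box»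
between ✓ `NE7EffectiveFormCoarseCurlAllLevels.effectiveForm_kernel_closed_flat_allLevels` (`ker Δ^{flat}_{j+1} ⊆` closed) and ✓ `NE7EffectiveFormFlatZeroModes` (`⊇` exact + constants).
WHAT ([folklore]; 0 def, 0 sorry):
* §1 `dPot_closed` (a coboundary is closed); **`closed_periodic_eq_const_add_dPot`** (complex scalars): a `P`-periodic `Y : ℤ^d → (Fin d → ℂ)` with
  `Y(x,μ) + Y(x+e_μ,ν) − Y(x+e_ν,μ) − Y(x,ν) = 0` everywhere is `Y(x,μ) = c_μ + (ζ(x+e_μ) − ζ(x))` with `ζ` `P`-periodic — via the flat Hodge split ✓ `NE3FlatHodgeSplit.exists_flatHodgeSplit`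
  (`Y = η + dPot ζ`, `η` co-closed): a closed AND co-closed periodic 1-form has torus-harmonic components (`torLap η_κ = (δη)(·+e_κ) − (δη)(·) = 0`), hence constant ones
  (✓ `const_of_torLap_eq_zero`: the discrete torus is connected) — the harmonic 1-forms of `(ℤ∕Pℤ)^d` are the constants.
* §2 `closed_periodic_matrix_eq_const_add_dPot` (entrywise) and **`closed_periodic_skew_eq_const_add_dPot`**: a closed periodic `𝔲(n)`-valued 1-form (flat dressed curl `curlAt 1 Y ≡ 0`) is
  `c_μ + (ζ(x+e_μ) − ζ(x))` with `c_μ ∈ 𝔲(n)` and a periodic `𝔲(n)`-valued `ζ` (symmetrisation by ✓ `skewP`).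
* §3 `curlAt_flatCfg_self`, `curlAt_flatCfg_eq_zero_of_swap`, `curlAt_flatCfg_eq_zero_of_perWin`: for a periodic field, vanishing of the flat curl on the period window `perWin d N` (base in `[0,N)^d`, ordered planes) is vanishing everywhere.
HONEST FRAMING: lattice kinematics on the flat torus; nothing of Bałaban's asserted; NOT NE7 as a spine node, NOT NE3; spine 0∕9; NOT infinite volume, NOT mass gap, NOT BetaPertH, NOT Clay.
-/

set_option autoImplicit false

open scoped BigOperators Matrix Matrix.Norms.L2Operator Topology
open NormedSpace Finset

namespace Summit.QuantumFields.BalabanUV.T4Continuum.NE7PeriodicDeRhamOneForms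

open Literature.MathematicalPhysics.QuantumFieldTheory.Balaban1983to89
open B7Prop1Explicit
open T4AveragingDeficitWall (curl curlAt)
open T4AveragingDeficitWallBoundary (periodBox)
open AveragingDeficitPeriodicCounting (IsPeriodicDir)
open AveragingDeficitTorusChart (redN eq_wrap_add periodic_smul_vec skewP skewP_mem skewP_of_mem skewP_apply)
open NE3TangentNoGoWords (dPot)
open NE3FlatHodgeSplit (TorSite te torLap toTor liftTor toTor_add_e toTor_sub_e toTor_liftTor periodic_apply_eq const_of_torLap_eq_zero exists_flatHodgeSplit dPot_periodic)
open MinimalActionLevels (perWin)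
open MinimalActionWitness (flatCfg)
open NE7FlatAverageCurlCommutation (curlAt_flatCfg curlAt_flatCfg_add_period)

noncomputable section

variable {d : ℕ}

/-! ## §1 Complex-valued closed periodic 1-forms -/

/-- A coboundary `dPot ζ` is closed. [folklore] -/
theorem dPot_closed (ζ : Site d → ℂ) (x : Site d) (μ ν : Fin d) :
    dPot ζ x μ + dPot ζ (x + e μ) ν - dPot ζ (x + e ν) μ - dPot ζ x ν = 0 := by
  simp only [dPot, add_right_comm x (e ν) (e μ)]
  abel

/-- **DISCRETE DE RHAM FOR PERIODIC COMPLEX 1-FORMS**: for `P ≥ 1`, a `P`-periodic `Y : ℤ^d → (Fin d → ℂ)` with vanishing lattice curl everywhere is a constant plus a coboundary with a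
`P`-periodic potential: `Y(x, μ) = c_μ + (ζ(x + e_μ) − ζ(x))`. [folklore] -/
theorem closed_periodic_eq_const_add_dPot {P : ℕ} (hP : 1 ≤ P) (Y : Site d → Fin d → ℂ)
    (hY : ∀ (x : Site d) (τ μ : Fin d), Y (x + (P : ℤ) • e τ) μ = Y x μ)
    (hcl : ∀ (x : Site d) (μ ν : Fin d), Y x μ + Y (x + e μ) ν - Y (x + e ν) μ - Y x ν = 0) :
    ∃ (c : Fin d → ℂ) (ζ : Site d → ℂ), (∀ (x : Site d) (τ : Fin d), ζ (x + (P : ℤ) • e τ) = ζ x) ∧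
      ∀ (x : Site d) (μ : Fin d), Y x μ = c μ + dPot ζ x μ := by
  haveI : NeZero P := ⟨by omega⟩
  obtain ⟨ζ, hζP, hco⟩ := exists_flatHodgeSplit hP Y hY
  -- the co-closed remainder `η := Y − dPot ζ`
  set η : Site d → Fin d → ℂ := fun x κ => Y x κ - dPot ζ x κ with hη
  have hηP : ∀ (x : Site d) (τ μ : Fin d), η (x + (P : ℤ) • e τ) μ = η x μ := by
    intro x τ μ; simp only [hη, hY, dPot_periodic hζP]
  have hηcl : ∀ (x : Site d) (μ ν : Fin d), η x μ + η (x + e μ) ν - η (x + e ν) μ - η x ν = 0 := by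
    intro x μ ν
    have h1 := hcl x μ ν
    have h2 := dPot_closed ζ x μ ν
    simp only [hη]
    linear_combination h1 - h2
  have hηco : ∀ x : Site d, ∑ κ : Fin d, (η x κ - η (x - e κ) κ) = 0 := fun x => hco x
  -- each component is torus-harmonic, hence constant
  have hconst : ∀ (κ : Fin d) (x : Site d), η x κ = η (liftTor (0 : TorSite d P)) κ := by
    intro κ
    set ηκ : Site d → ℂ := fun y => η y κ with hηκ
    set u : TorSite d P → ℂ := fun t => ηκ (liftTor t) with hu
    have hper : ∀ (x : Site d) (τ : Fin d), ηκ (x + (P : ℤ) • e τ) = ηκ x := fun x τ => hηP x τ κ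
    have hstep : ∀ (t : TorSite d P) (μ : Fin d), u (t + te μ) = η (liftTor t + e μ) κ := by
      intro t μ
      have h := periodic_apply_eq (P := P) (g := ηκ) hper (liftTor t + e μ)
      rw [toTor_add_e, toTor_liftTor] at h
      exact h.symm
    have hstep' : ∀ (t : TorSite d P) (μ : Fin d), u (t - te μ) = η (liftTor t - e μ) κ := by
      intro t μ
      have h := periodic_apply_eq (P := P) (g := ηκ) hper (liftTor t - e μ)
      rw [toTor_sub_e, toTor_liftTor] at h
      exact h.symm
    have hlap : torLap u = 0 := by
      funext t
      set x : Site d := liftTor t with hx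
      simp only [torLap, hstep, hstep', Pi.zero_apply]
      have hu0 : u t = η x κ := rfl
      simp only [hu0]
      -- closedness converts `κ`-components along `μ` into `μ`-components along `κ`
      have hrw : ∀ μ : Fin d, η (x + e μ) κ - 2 * η x κ + η (x - e μ) κ
          = (η (x + e κ) μ - η (x + e κ - e μ) μ) - (η x μ - η (x - e μ) μ) := by
        intro μ
        have h1 := hηcl x μ κ
        have h2 := hηcl (x - e μ) μ κ
        rw [sub_add_cancel] at h2
        rw [show x + e κ - e μ = x - e μ + e κ by abel]
        linear_combination h1 - h2
      rw [Finset.sum_congr rfl fun μ _ => hrw μ, Finset.sum_sub_distrib, hηco x, hηco (x + e κ), sub_self]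
    intro x
    have h1 := periodic_apply_eq (P := P) (g := ηκ) hper x
    have h2 := const_of_torLap_eq_zero u hlap (toTor P x)
    exact h1.trans h2
  refine ⟨fun κ => η (liftTor (0 : TorSite d P)) κ, ζ, hζP, fun x μ => ?_⟩
  show Y x μ = η (liftTor (0 : TorSite d P)) μ + dPot ζ x μ
  rw [← hconst μ x]
  simp only [hη, sub_add_cancel]

/-! ## §2 Matrix-valued and `𝔲(n)`-valued closed periodic 1-forms -/

variable {n : Type*} [Fintype n] [DecidableEq n]

/-- **Matrix-valued de Rham** (entrywise): a `P`-periodic matrix 1-form with vanishing flat curl everywhere is a constant plus a coboundary with a periodic matrix potential. [folklore] -/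
theorem closed_periodic_matrix_eq_const_add_dPot {P : ℕ} (hP : 1 ≤ P) (Y : Site d → Fin d → Matrix n n ℂ) (hY : IsPeriodicDir Y (P : ℤ))
    (hcl : ∀ (x : Site d) (μ ν : Fin d), curlAt (flatCfg : Site d → Fin d → (Matrix n n ℂ)ˣ) Y x μ ν = 0) :
    ∃ (c : Fin d → Matrix n n ℂ) (ζ : Site d → Matrix n n ℂ), (∀ (x : Site d) (τ : Fin d), ζ (x + (P : ℤ) • e τ) = ζ x) ∧
      ∀ (x : Site d) (μ : Fin d), Y x μ = c μ + (ζ (x + e μ) - ζ x) := by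
  have hent : ∀ ab : n × n, ∃ (c : Fin d → ℂ) (ζ : Site d → ℂ), (∀ (x : Site d) (τ : Fin d), ζ (x + (P : ℤ) • e τ) = ζ x) ∧
      ∀ (x : Site d) (μ : Fin d), Y x μ ab.1 ab.2 = c μ + dPot ζ x μ := by
    intro ab
    refine closed_periodic_eq_const_add_dPot hP (fun x μ => Y x μ ab.1 ab.2) (fun x τ μ => by rw [hY x τ μ]) fun x μ ν => ?_
    have h := congr_fun (congr_fun (hcl x μ ν) ab.1) ab.2
    simpa only [curlAt_flatCfg, Matrix.sub_apply, Matrix.add_apply, Matrix.zero_apply] using h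
  choose c ζ hζP hYe using hent
  refine ⟨fun μ => Matrix.of fun a b => c (a, b) μ, fun x => Matrix.of fun a b => ζ (a, b) x, fun x τ => ?_, fun x μ => ?_⟩
  · ext a b
    simp only [Matrix.of_apply, hζP]
  · ext a b
    simp only [Matrix.add_apply, Matrix.sub_apply, Matrix.of_apply, hYe (a, b) x μ, dPot]

omit [DecidableEq n] in
/-- `skewP` commutes with differences. [folklore] -/
theorem skewP_sub (X Y : Matrix n n ℂ) : skewP (X - Y) = skewP X - skewP Y := map_sub skewP X Y

/-- **`𝔲(n)`-valued de Rham**: a `P`-periodic `𝔲(n)`-valued 1-form with vanishing flat curl everywhere is `c_μ + (ζ(x + e_μ) − ζ(x))` with `c_μ ∈ 𝔲(n)` and a `P`-periodic `𝔲(n)`-valued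
potential `ζ` (entrywise de Rham, then the skew part). [folklore] -/
theorem closed_periodic_skew_eq_const_add_dPot {P : ℕ} (hP : 1 ≤ P) (Y : Site d → Fin d → Matrix n n ℂ) (hY : IsPeriodicDir Y (P : ℤ))
    (hYs : ∀ (x : Site d) (μ : Fin d), Y x μ ∈ skewAdjoint (Matrix n n ℂ))
    (hcl : ∀ (x : Site d) (μ ν : Fin d), curlAt (flatCfg : Site d → Fin d → (Matrix n n ℂ)ˣ) Y x μ ν = 0) :
    ∃ (c : Fin d → Matrix n n ℂ) (ζ : Site d → Matrix n n ℂ), (∀ μ : Fin d, c μ ∈ skewAdjoint (Matrix n n ℂ)) ∧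
      (∀ x : Site d, ζ x ∈ skewAdjoint (Matrix n n ℂ)) ∧ (∀ (x : Site d) (τ : Fin d), ζ (x + (P : ℤ) • e τ) = ζ x) ∧
      ∀ (x : Site d) (μ : Fin d), Y x μ = c μ + (ζ (x + e μ) - ζ x) := by
  obtain ⟨c, ζ, hζP, hYe⟩ := closed_periodic_matrix_eq_const_add_dPot hP Y hY hcl
  refine ⟨fun μ => skewP (c μ), fun x => skewP (ζ x), fun μ => skewP_mem _, fun x => skewP_mem _, fun x τ => by simp only [hζP], fun x μ => ?_⟩
  rw [← skewP_of_mem (hYs x μ), hYe x μ, map_add, skewP_sub]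

/-! ## §3 From the period window to everywhere -/

/-- The box representative of a site lies in the period box. [folklore] -/
theorem boxVec_redN_mem_periodBox {N : ℕ} [NeZero N] (z : Site d) : boxVec N (redN N z) ∈ periodBox (d := d) N := by
  unfold periodBox
  exact Finset.mem_image_of_mem _ (Finset.mem_univ _)

/-- `curl` on an indexed plaquette is `curlAt` at its base and plane. [folklore] -/
theorem curl_eq_curlAt (V : Site d → Fin d → (Matrix n n ℂ)ˣ) (ψ : Site d → Fin d → Matrix n n ℂ) (b : Site d) (π : T4AveragingDeficitWall.Plane d) :
    curl V ψ (b, π) = curlAt V ψ b π.1.1 π.1.2 := rfl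

/-- The flat curl on a degenerate plane vanishes. [folklore] -/
theorem curlAt_flatCfg_self (ψ : Site d → Fin d → Matrix n n ℂ) (z : Site d) (μ : Fin d) :
    curlAt (flatCfg : Site d → Fin d → (Matrix n n ℂ)ˣ) ψ z μ μ = 0 := by
  rw [curlAt_flatCfg]
  abel

/-- The flat curl is antisymmetric in the plane: vanishing for `(ν, μ)` gives vanishing for `(μ, ν)`. [folklore] -/
theorem curlAt_flatCfg_eq_zero_of_swap (ψ : Site d → Fin d → Matrix n n ℂ) (z : Site d) (μ ν : Fin d)
    (h1 : curlAt (flatCfg : Site d → Fin d → (Matrix n n ℂ)ˣ) ψ z ν μ = 0) :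
    curlAt (flatCfg : Site d → Fin d → (Matrix n n ℂ)ˣ) ψ z μ ν = 0 := by
  rw [curlAt_flatCfg] at h1 ⊢
  have h2 : ψ z μ + ψ (z + e μ) ν - ψ (z + e ν) μ - ψ z ν = -(ψ z ν + ψ (z + e ν) μ - ψ (z + e μ) ν - ψ z μ) := by abel
  rw [h2, h1, neg_zero]

/-- For an `N`-periodic field, vanishing of the flat curl on the period window `perWin d N` (bases in `[0,N)^d`, ordered planes `μ < ν`) is vanishing at every base and every pair of directions.
[folklore] -/
theorem curlAt_flatCfg_eq_zero_of_perWin {N : ℕ} [NeZero N] {ψ : Site d → Fin d → Matrix n n ℂ} (hψ : IsPeriodicDir ψ (N : ℤ))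
    (h : ∀ P ∈ perWin d N, curl (flatCfg : Site d → Fin d → (Matrix n n ℂ)ˣ) ψ P = 0) (z : Site d) (μ ν : Fin d) :
    curlAt (flatCfg : Site d → Fin d → (Matrix n n ℂ)ˣ) ψ z μ ν = 0 := by
  -- reduce the base to the period box on ordered planes
  have hbox : ∀ (μ ν : Fin d), μ < ν → ∀ z : Site d, curlAt (flatCfg : Site d → Fin d → (Matrix n n ℂ)ˣ) ψ z μ ν = 0 := by
    intro μ ν hμν z
    have hw : curlAt (flatCfg : Site d → Fin d → (Matrix n n ℂ)ˣ) ψ z μ ν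
        = curlAt (flatCfg : Site d → Fin d → (Matrix n n ℂ)ˣ) ψ (boxVec N (redN N z)) μ ν := by
      conv_lhs => rw [eq_wrap_add N z]
      exact periodic_smul_vec (f := fun y => curlAt (flatCfg : Site d → Fin d → (Matrix n n ℂ)ˣ) ψ y μ ν)
        (fun y i => curlAt_flatCfg_add_period hψ y i μ ν) _ _
    rw [hw]
    have hP : (boxVec N (redN N z), (⟨(μ, ν), hμν⟩ : T4AveragingDeficitWall.Plane d)) ∈ perWin d N :=
      Finset.mk_mem_product (boxVec_redN_mem_periodBox z) (Finset.mem_univ _)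
    have h3 := h _ hP
    rw [curl_eq_curlAt] at h3
    exact h3
  rcases lt_trichotomy μ ν with hlt | heq | hgt
  · exact hbox μ ν hlt z
  · subst heq
    exact curlAt_flatCfg_self ψ z μ
  · exact curlAt_flatCfg_eq_zero_of_swap ψ z μ ν (hbox ν μ hgt z)

end

end Summit.QuantumFields.BalabanUV.T4Continuum.NE7PeriodicDeRhamOneForms
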